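import Literature.NumberTheory.NumberFields.ClassGroupNormKernelOneRamifiedPrime
import Literature.NumberTheory.NumberFields.AmbiguousClassNumberFormula
import Literature.NumberTheory.NumberFields.HilbertTheorem92
import HarnessLib

/-!
# One totally ramified prime: the number of ambiguous classes is `h_B`, and every unit of `B` is a norm from `F`
# (Chevalley's formula, Lang Ch. 13 §4 Lemma 4.1, in the situation of Lang Ch. 5 §4 Thm. 4.1 / Washington Prop. 13.22)

Topic `NumberTheory/NumberFields` (namespace = path, grouping sub-namespace `ClassGroupNormKernel`).  THEOREM-ONLY file (no
definition, no named fact, no `sorry`), written by the prover seat `bsd-wall-rtt-p4-w2` g20 (cell `bsd-wall`; `--supports`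
stmt-BirchSwinnertonDyer-21438, line `nonsquare-descent` stub S2 — «units modulo norms»; closes nothing; BSD is proved for no curve here).
Sequel of `ClassGroupNormKernelOneRamifiedPrime.lean` (`ker N_{F/B} = I_G Cl(F)`).

Let `F/B` be a CYCLIC extension of number fields (`Gal(F/B) = ⟨σ⟩`), unramified at the infinite places, with a prime `𝔓` of `F` totally
ramified over `B` (`e(𝔓 | B) = [F : B]`) and every other prime of `F` unramified over `B`.

* **`card_fixed_eq_classNumber`** — the number of AMBIGUOUS (Galois-fixed) ideal classes of `F` is the class number of the base:
  `#Cl(F)^G = h_B`.  (For a finite `G = ⟨σ⟩`-module `A`, `#A^G = #ker(σ−1) = #A / #(σ−1)A = #A_G`, and `#(σ−1)Cl(F) = #ker N = h_F / h_B` by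
  `card_closure_mul_card_classGroup`.)  This is Chevalley's count `#Cl(F)^G = h_B ∏_v e_v / ([F:B] [E_B : E_B ∩ N Fˣ])` in this ramification
  situation, obtained WITHOUT the unit group — whence, comparing with the tree's `AmbiguousClass.ambiguousClassNumberFormula`:
* `finprod_ramificationIdxIn_eq_finrank` — `∏_𝔮 e_𝔮 = [F : B]` (only `𝔭 = 𝔓 ∩ B` ramifies, `e_𝔭 = [F:B]`);
* **`relIndex_unitsNorm_eq_one`**, **`unitsE_inf_range_le_map_norm`** — `[E_B : E_B ∩ N_{F/B} Fˣ] = 1`: EVERY UNIT OF `B` IS THE NORM OF AN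
  ELEMENT OF `F` (in the tree's currency of `CyclicNormIndex`/`MinkowskiUnit`: `unitsE F ⊓ (unitsIncl B F).range ≤ N_G(Fˣ)`,
  `N_G = Herbrand.norm (F ≃ₐ[B] F)`).  (Classically: a unit is a local norm at every unramified place, hence — product formula, one ramified
  place — everywhere, and Hasse's norm theorem for cyclic `F/B` concludes; here it drops out of genus theory.)

References: [Lang1990] S. Lang, *Cyclotomic Fields I and II*, Ch. 13 §4 Lemma 4.1 (held, PDF p. 203) and Ch. 5 §4 Thm. 4.1 (PDF p. 104);
[Washington1997] §13.3 Prop. 13.22; [Gras2003] G. Gras, *Class Field Theory*, II.6.2.3, IV.4 (genus theory).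
-/

noncomputable section

open NumberField IsDedekindDomain Ideal
open scoped nonZeroDivisors Pointwise

namespace Literature.NumberTheory.NumberFields

namespace ClassGroupNormKernel

open Literature.NumberTheory.GaloisRepresentations Literature.NumberTheory.GaloisRepresentations.Herbrand
  Literature.NumberTheory.GaloisRepresentations.MinkowskiUnit Literature.NumberTheory.GaloisRepresentations.CyclicNormIndex
  Literature.NumberTheory.NumberFields.AmbiguousClass

variable {B F : Type} [Field B] [NumberField B] [Field F] [NumberField F] [Algebra B F] [IsGalois B F]

omit [IsGalois B F] in
/-- A class fixed by a generator `σ` of `Gal(F/B)` is fixed by the whole group. [folklore] -/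
private theorem forall_mulEquiv_eq_of_eq {σ : F ≃ₐ[B] F} (hσ : ∀ τ : F ≃ₐ[B] F, τ ∈ Subgroup.zpowers σ)
    {c : ClassGroup (𝓞 F)} (hc : ClassGroup.mulEquiv (intAut σ) c = c) (τ : F ≃ₐ[B] F) :
    ClassGroup.mulEquiv (intAut τ) c = c := by
  have hτ := hσ τ
  rw [← (_root_.isOfFinOrder_of_finite σ).mem_powers_iff_mem_zpowers, Submonoid.mem_powers_iff] at hτ
  obtain ⟨n, rfl⟩ := hτ
  induction n with
  | zero => rw [_root_.pow_zero, AmbiguousClass.mulEquiv_intAut_one, MulEquiv.refl_apply]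
  | succ n ih => rw [_root_.pow_succ', AmbiguousClass.mulEquiv_intAut_mul, MulEquiv.trans_apply, ih, hc]

/-- **`#Cl(F)^G = h_B`: with one totally ramified prime (cyclic `F/B`, unramified at infinity) the number of ambiguous ideal classes of
`F` equals the class number of `B`.**  `#Cl(F)^{⟨σ⟩} = #ker(c ↦ σc/c) = h_F / #{σc/c} = h_F / #ker N_{F/B} = h_B`
(`closure_eq_range_of_zpowers_eq_top`, `card_closure_mul_card_classGroup`).  Chevalley's formula in this ramification situation, proved
without units. [cite: Lang1990, Ch. 13 §4 Lemma 4.1 (PDF p. 203) and Ch. 5 §4 Thm. 4.1 (iii) (PDF p. 104)]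
[cite: Washington1997, §13.3 Prop. 13.22] -/
theorem card_fixed_eq_classNumber [IsUnramifiedAtInfinitePlaces B F] {σ : F ≃ₐ[B] F}
    (hσ : ∀ τ : F ≃ₐ[B] F, τ ∈ Subgroup.zpowers σ)
    (𝔓 : Ideal (𝓞 F)) [𝔓.IsMaximal] (h𝔓 : 𝔓.ramificationIdx (𝓞 B) = Module.finrank B F)
    (huniq : ∀ (Q : Ideal (𝓞 F)) [Q.IsMaximal], Q.ramificationIdx (𝓞 B) ≠ 1 → Q = 𝔓) :
    Nat.card {c : ClassGroup (𝓞 F) // ∀ τ : F ≃ₐ[B] F, ClassGroup.mulEquiv (intAut τ) c = c} = classNumber B := by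
  classical
  have hσ' : Subgroup.zpowers σ = ⊤ := (Subgroup.eq_top_iff' _).mpr hσ
  set f : ClassGroup (𝓞 F) →* ClassGroup (𝓞 F) :=
    (ClassGroup.mulEquiv (intAut σ)).toMonoidHom / MonoidHom.id (ClassGroup (𝓞 F)) with hf
  have hf_apply : ∀ d, f d = ClassGroup.mulEquiv (intAut σ) d / d := fun d => rfl
  -- the fixed classes are `ker f`
  have hcard : Nat.card {c : ClassGroup (𝓞 F) // ∀ τ : F ≃ₐ[B] F, ClassGroup.mulEquiv (intAut τ) c = c} =
      Nat.card f.ker := by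
    refine Nat.card_congr (Equiv.subtypeEquivRight fun c => ?_)
    rw [MonoidHom.mem_ker, hf_apply, div_eq_one]
    exact ⟨fun h => h σ, fun h τ => forall_mulEquiv_eq_of_eq hσ h τ⟩
  -- `#ker f · #range f = h_F` and `#range f · h_B = h_F`
  have h1 : Nat.card f.range * Nat.card f.ker = Fintype.card (ClassGroup (𝓞 F)) := by
    rw [← Nat.card_eq_fintype_card, ← Nat.card_congr (QuotientGroup.quotientKerEquivRange f).toEquiv]
    exact (Subgroup.card_eq_card_quotient_mul_card_subgroup f.ker).symm
  have h2 : Nat.card f.range * Fintype.card (ClassGroup (𝓞 B)) = Fintype.card (ClassGroup (𝓞 F)) := by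
    rw [hf, ← closure_eq_range_of_zpowers_eq_top σ hσ']
    exact card_closure_mul_card_classGroup 𝔓 h𝔓 huniq
  have hpos : 0 < Nat.card f.range := Nat.card_pos
  rw [hcard]
  exact Nat.eq_of_mul_eq_mul_left hpos (h1.trans h2.symm)

omit [IsGalois B F] in
/-- **`∏_𝔮 e_𝔮 = [F : B]`** when `𝔓` is totally ramified over `B` and every other prime of `F` is unramified: the only prime of `B` with
`e ≠ 1` is `𝔭 = 𝔓 ∩ B`, and `e_𝔭 = e(𝔓 | B) = [F : B]` (Galois). [cite: NeukirchANT1999, Ch. I §9 (9.1)] [folklore] -/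
theorem finprod_ramificationIdxIn_eq_finrank [IsGalois B F] (𝔓 : Ideal (𝓞 F)) [𝔓.IsMaximal]
    (h𝔓 : 𝔓.ramificationIdx (𝓞 B) = Module.finrank B F)
    (huniq : ∀ (Q : Ideal (𝓞 F)) [Q.IsMaximal], Q.ramificationIdx (𝓞 B) ≠ 1 → Q = 𝔓) :
    (∏ᶠ v : HeightOneSpectrum (𝓞 B), v.asIdeal.ramificationIdxIn (𝓞 F)) = Module.finrank B F := by
  classical
  have h𝔓0 : 𝔓 ≠ ⊥ := Ring.ne_bot_of_isMaximal_of_not_isField ‹_› (RingOfIntegers.not_isField F)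
  haveI : (𝔓.under (𝓞 B)).IsMaximal := Ideal.IsMaximal.under (𝓞 B) 𝔓
  obtain ⟨v₀, hv₀⟩ : ∃ v₀ : HeightOneSpectrum (𝓞 B), v₀.asIdeal = 𝔓.under (𝓞 B) :=
    ⟨⟨𝔓.under (𝓞 B), inferInstance, mt Ideal.eq_bot_of_comap_eq_bot h𝔓0⟩, rfl⟩
  -- the value at `v₀`
  have hval : v₀.asIdeal.ramificationIdxIn (𝓞 F) = Module.finrank B F := by
    haveI : 𝔓.LiesOver v₀.asIdeal := ⟨hv₀⟩
    haveI : v₀.asIdeal.IsMaximal := v₀.isMaximal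
    rw [Ideal.ramificationIdxIn_eq_ramificationIdx v₀.asIdeal 𝔓 (F ≃ₐ[B] F), h𝔓]
  -- every other place has `e = 1`
  have hother : ∀ v : HeightOneSpectrum (𝓞 B), v ≠ v₀ → v.asIdeal.ramificationIdxIn (𝓞 F) = 1 := by
    intro v hv
    haveI : v.asIdeal.IsMaximal := v.isMaximal
    obtain ⟨Q, hQmax, hQv⟩ := Ideal.exists_maximal_ideal_liesOver_of_isIntegral (S := 𝓞 F) v.asIdeal
    haveI := hQmax
    haveI := hQv
    rw [Ideal.ramificationIdxIn_eq_ramificationIdx v.asIdeal Q (F ≃ₐ[B] F)]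
    by_contra hne
    have hQ : Q = 𝔓 := huniq Q hne
    apply hv
    apply HeightOneSpectrum.ext
    rw [hv₀, ← hQ, hQv.over]
  rw [finprod_eq_single _ v₀ hother, hval]

/-- **`[E_B : E_B ∩ N_{F/B} Fˣ] = 1`** for `F/B` cyclic, unramified at the infinite places, with one totally ramified prime and no other
ramification: Chevalley's ambiguous class number formula `#Cl(F)^G · [F:B] · [E_B : E_B ∩ N Fˣ] = h_B · ∏_𝔮 e_𝔮 · ∏_{v∣∞} e_v` (tree
`AmbiguousClass.ambiguousClassNumberFormula`) with `#Cl(F)^G = h_B`, `∏ e_𝔮 = [F:B]`, `∏_{v∣∞} e_v = 1`.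
[cite: Lang1990, Ch. 13 §4 Lemma 4.1 (PDF p. 203)] [cite: Gras2003, II.6.2.3] -/
theorem relIndex_unitsNorm_eq_one [IsUnramifiedAtInfinitePlaces B F] {σ : F ≃ₐ[B] F}
    (hσ : ∀ τ : F ≃ₐ[B] F, τ ∈ Subgroup.zpowers σ)
    (𝔓 : Ideal (𝓞 F)) [𝔓.IsMaximal] (h𝔓 : 𝔓.ramificationIdx (𝓞 B) = Module.finrank B F)
    (huniq : ∀ (Q : Ideal (𝓞 F)) [Q.IsMaximal], Q.ramificationIdx (𝓞 B) ≠ 1 → Q = 𝔓) :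
    (unitsE F ⊓ (⊤ : Subgroup Fˣ).map (Herbrand.norm (F ≃ₐ[B] F))).relIndex (unitsE F ⊓ (unitsIncl B F).range) = 1 := by
  have h := ambiguousClassNumberFormula hσ
  rw [card_fixed_eq_classNumber hσ 𝔓 h𝔓 huniq, finprod_ramificationIdxIn_eq_finrank 𝔓 h𝔓 huniq, archFactor_eq_one, mul_one] at h
  have hpos : 0 < classNumber B * Module.finrank B F := Nat.mul_pos (classNumber_pos B) Module.finrank_pos
  have h' : classNumber B * Module.finrank B F *
      (unitsE F ⊓ (⊤ : Subgroup Fˣ).map (Herbrand.norm (F ≃ₐ[B] F))).relIndex (unitsE F ⊓ (unitsIncl B F).range) =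
      classNumber B * Module.finrank B F * 1 := by rw [mul_one]; exact h
  exact Nat.eq_of_mul_eq_mul_left hpos h'

/-- **Every unit of `B` is the norm of an element of `F`**: `E_B ⊆ N_{F/B} Fˣ` for `F/B` cyclic, unramified at the infinite places, with one
totally ramified prime and no other ramification (`E_B = 𝓞_Fˣ ∩ Bˣ` inside `Fˣ`, `N_{F/B} Fˣ = N_G(Fˣ)`, `N_G y = ∏_{g} g y`).
[cite: Lang1990, Ch. 13 §4 Lemma 4.1 (PDF p. 203)] [cite: Gras2003, II.6.2.3 and IV.4] -/
theorem unitsE_inf_range_le_map_norm [IsUnramifiedAtInfinitePlaces B F] {σ : F ≃ₐ[B] F}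
    (hσ : ∀ τ : F ≃ₐ[B] F, τ ∈ Subgroup.zpowers σ)
    (𝔓 : Ideal (𝓞 F)) [𝔓.IsMaximal] (h𝔓 : 𝔓.ramificationIdx (𝓞 B) = Module.finrank B F)
    (huniq : ∀ (Q : Ideal (𝓞 F)) [Q.IsMaximal], Q.ramificationIdx (𝓞 B) ≠ 1 → Q = 𝔓) :
    unitsE F ⊓ (unitsIncl B F).range ≤ (⊤ : Subgroup Fˣ).map (Herbrand.norm (F ≃ₐ[B] F)) := by
  have h := relIndex_unitsNorm_eq_one hσ 𝔓 h𝔓 huniq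
  rw [Subgroup.relIndex_eq_one] at h
  exact fun x hx => (h hx).2

end ClassGroupNormKernel

end Literature.NumberTheory.NumberFields

end
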